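import Summits.FinalStateConjecture.FinalStateConjecture.Theorems.StarvedNecksSeamedChartsExhaustRide
import Summits.FinalStateConjecture.FinalStateConjecture.Theorems.StarvedNecksSeamedChartsExhaustStubRim
import Summits.FinalStateConjecture.FinalStateConjecture.Theorems.StarvedNecksDiagonalRadii
import Summits.FinalStateConjecture.FinalStateConjecture.Theses.StarvedNecks
import Literature.Geometry.Lorentzian.CausalityPushUp

/-!
# Route StarvedNecks — crux `SeamedChartsExhaust` PROVED (line `wide-anchoring`, generation 2)

`Summit.FinalStateConjecture.FinalStateConjecture.Theses.StarvedNecks.SeamedChartsExhaust` (item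
stmt-FinalStateConjecture-13551): for every admissible datum, every maximal vacuum Cauchy development
`𝒟`, every region `O`, every `C²` final-state decomposition `d` of `O` with radii `R`, `R₀`:
`O = exteriorOf 𝒟 d.charted`, HonestCore`(d, R₀)` and SEAMED`(d, R, R₀)` imply
`Summit.FinalStateConjecture.HasExhaustiveCharts d` (with these very `R`).

Contents: `wideAnchoring` (the lever of the line: HonestCore (b) at the `τ₁`-dependent radius
`Rᵢ(τ₁)` makes the disc of (b) the hole part of the certified slab), `chartedReach` (REACH),
`firstEntryCovering`, `exteriorOf_causallyConvex`, `frontierBelowSlab` (FRONTIER), `seamedChartsExhaust`.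
Repair 2026-08-16 (summit re-typing, honest growing radii in `HasExhaustiveCharts`): the witness radii
are the SEAMED `R` enlarged diagonally (cf. `StarvedNecksSeamedChartsExhaustHonestRadii.lean`).

Proof (the line's composition): clause (i) of `HasExhaustiveCharts` is SEAMED (2) verbatim.
For the covering clause (ii) `O \ certifiedLate d R τ₁ ⊆ J⁻(certifiedSlab d R τ₁)`, `τ₁ > τ₀`:
the self-determined exterior `O = J⁺(ι X) ∩ I⁻(d.charted)` is cofinal under the charts and causally
convex (`exteriorOf_causallyConvex`, the only place the shape of `O` enters; no field equation,
maximality or admissibility is used); the certified late region `F` is open (`isOpen_certifiedLate`);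
every charted point outside `F` drains to the certified slab (`chartedReach`: BOARD by first contact +
ride, hole points by wide anchoring); the frontier of `F` inside `O` drains to the slab
(`frontierBelowSlab`: the rim enumeration `stub_rim` lands on the slab or on ride-able tube points,
which ride by `tubeRide`); and the metric-free FIRST-ENTRY covering lemma (`firstEntryCovering`: first
parameter of ONE timelike curve from `p` in `F`) concludes.

Clause ledger (HonestCore (a) orthochronous + `100M ≤ R₀`, (b), (c), (d); SEAMED (1), (2), (5)–(12);
UNUSED: sub-extremality, SEAMED (3), (4) — as predicted by the standing disprover's analysis).

References: B. O'Neill, *Semi-Riemannian geometry*, Academic Press 1983, Ch. 14, pp. 402–403;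
E. Minguzzi, Living Rev. Relativ. 22 (2019) 3 = arXiv:1709.06494, §2; M. Dafermos, G. Holzegel,
I. Rodnianski, M. Taylor, arXiv:2104.08222, §1; P. Chruściel, J. Costa, M. Heusler, Living Rev.
Relativ. 15 (2012) 7, §2.4 (domain of outer communications, causal convexity).
-/

noncomputable section

set_option linter.dupNamespace false

open Set Filter Topology Function TopologicalSpace
open scoped Manifold ContDiff ENNReal Topology
open Literature.Geometry.Lorentzian

namespace Summit.FinalStateConjecture.FinalStateConjecture.Theorems.SeamedChartsExhaust.WideAnchoring

/-- **Wide anchoring**: HonestCore (b) at the `τ₁`-dependent radius `ϱ := Rᵢ(τ₁)` (admissible by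
SEAMED (1): `R₀ + 4 ≤ Rᵢ`) and `τ₂ := τ₁` puts the whole sub-slab part of hole `i`'s tube into
`J⁻(certifiedSlab d R τ₁)`. No flow. DHRT arXiv:2104.08222, §1. [folklore] -/
theorem wideAnchoring {𝓢 : Spacetime.{0} 4} {O : Set 𝓢.carrier} (d : FinalStateDecomposition 𝓢 O 2)
    (R : Fin d.N → ℝ → ℝ) (R₀ : ℝ)
    (hb : ∀ i (ϱ τ₂ : ℝ), R₀ ≤ ϱ → d.τ₀ < τ₂ →
      d.chart i '' {x | d.τ₀ < (d.background i).time x.1 ∧ (d.background i).time x.1 < τ₂ ∧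
        (d.background i).radius x.1 < ϱ} ⊆
      𝓢.metric.causalPast 𝓢.timeOrientation (d.chart i '' (d.background i).truncTimeSlab ϱ τ₂))
    (hR4 : ∀ i s, R₀ + 4 ≤ R i s) {τ₁ : ℝ} (hτ₁ : d.τ₀ < τ₁) (i : Fin d.N) :
    d.chart i '' {x | d.τ₀ < (d.background i).time x.1 ∧ (d.background i).time x.1 < τ₁ ∧
        (d.background i).radius x.1 < R i τ₁} ⊆
      𝓢.metric.causalPast 𝓢.timeOrientation (certifiedSlab d R τ₁) := by
  have hR₀ : R₀ ≤ R i τ₁ := by linarith [hR4 i τ₁]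
  refine (hb i (R i τ₁) τ₁ hR₀ hτ₁).trans (LorentzianMetric.causalFuture_mono ?_)
  intro m hm
  exact Or.inr (mem_iUnion.mpr ⟨i, hm⟩)

/-- **REACH**: every charted point `q ∉ certifiedLate d R τ₁` lies in `J⁻(certifiedSlab d R τ₁)`.
Routing: `q` flat-late with lab time `≤ τ₁` — BOARD (`flatBoarding`); `q = Ψᵢ x` hole-late with
`t = t*ᵢ x`, `r = rᵢ x`: `t < τ₁ ∧ r < Rᵢ(τ₁)` — wide anchoring; `t = τ₁ ∧ r ≤ Rᵢ(τ₁)` — on the disc;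
otherwise `Rᵢ(t) ≤ r` (`R` monotone when `t < τ₁`; `q ∉ F` when `t > τ₁`) and then the collar
(`collar_flat`) or the far leaf (SEAMED (10)) make `q` a flat-late point with lab time `≤ τ₁` (because
`q ∉ F`) — BOARD again. Clauses: Hc (a) `100M ≤ R₀` + orthochronous, (b), (d); Sm (1), (5)–(10), (12).
O'Neill 1983, Ch. 14, pp. 402–403; DHRT arXiv:2104.08222, §1. [folklore] -/
theorem chartedReach (𝓢 : Spacetime.{0} 4) (O : Set 𝓢.carrier) (d : FinalStateDecomposition 𝓢 O 2)
    (R : Fin d.N → ℝ → ℝ) (R₀ : ℝ)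
    (ha : ∀ i, 100 * d.mass i ≤ R₀)
    (horth : ∀ i, 0 < ((d.motion i).1 : E4 ≃L[ℝ] E4) (E4.basisVector 0) 0)
    (hb : ∀ i (ϱ τ₂ : ℝ), R₀ ≤ ϱ → d.τ₀ < τ₂ →
      d.chart i '' {x | d.τ₀ < (d.background i).time x.1 ∧ (d.background i).time x.1 < τ₂ ∧
        (d.background i).radius x.1 < ϱ} ⊆
      𝓢.metric.causalPast 𝓢.timeOrientation (d.chart i '' (d.background i).truncTimeSlab ϱ τ₂))
    (hd : ∀ y : d.flatDomain, d.τ₀ < y.1 0 →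
      𝓢.timeOrientation.IsFutureDirected (mfderiv 𝓘(ℝ, E4) (𝓡 4) d.flatChart y (E4.basisVector 0)))
    (h1 : ∀ i, Monotone (R i) ∧ Continuous (R i) ∧ ∀ s, R₀ + 4 ≤ R i s ∧ R₀ ≤ d.excision i s)
    (h5 : ∀ i (x : (d.background i).domain),
      (d.τ₀ ≤ (d.background i).time x.1 ∨ d.τ₀ ≤ x.1 0) → R₀ ≤ (d.background i).radius x.1 →
      (d.background i).radius x.1 ≤ R i ((d.background i).time x.1) →
      𝓢.timeOrientation.IsFutureDirected
        (mfderiv 𝓘(ℝ, E4) (𝓡 4) (d.chart i) x (((d.motion i).1 : E4 ≃L[ℝ] E4) (E4.basisVector 0))))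
    (h6 : ∀ i (y : E4) (hy : y ∈ (d.background i).domain), d.τ₀ ≤ y 0 →
      (∀ j, d.excision j (y 0) < (d.background j).radius y) →
      (d.background i).radius y ≤ R i ((d.background i).time y) + 1 →
      ∃ hy' : y ∈ d.flatDomain, d.chart i ⟨y, hy⟩ = d.flatChart ⟨y, hy'⟩)
    (h7 : ∀ y : d.flatDomain, d.τ₀ ≤ y.1 0 → ∀ j, d.excision j (y.1 0) < (d.background j).radius y.1)
    (h8 : ∀ j (y : E4), d.τ₀ ≤ y 0 → (d.background j).radius y ≤ d.excision j (y 0) →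
      (d.background j).radius y + 2 ≤ R j ((d.background j).time y))
    (h9 : ∀ j (y : E4), d.τ₀ ≤ (d.background j).time y →
      (d.background j).radius y ≤ R j ((d.background j).time y) + 2 → (d.background j).time y ≤ y 0)
    (h10 : ∀ j, d.chart j '' {x | d.τ₀ < (d.background j).time x.1 ∧
      R j ((d.background j).time x.1) + 1 < (d.background j).radius x.1} ⊆ d.radiationZone)
    (h12 : ∀ j j' (y : E4), j ≠ j' → (d.τ₀ ≤ y 0 ∨ d.τ₀ ≤ (d.background j).time y) →
      (d.background j).radius y ≤ R j ((d.background j).time y) + 1 →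
      R j' ((d.background j').time y) + 1 < (d.background j').radius y)
    (τ₁ : ℝ) (hτ₁ : d.τ₀ < τ₁) :
    d.charted \ certifiedLate d R τ₁ ⊆ 𝓢.metric.causalPast 𝓢.timeOrientation (certifiedSlab d R τ₁) := by
  intro q hq
  obtain ⟨hq, hqF⟩ := hq
  -- flat-late representatives: in `F`, or BOARD
  have flat : ∀ (y : d.flatDomain), d.τ₀ < y.1 0 → d.flatChart y ∉ certifiedLate d R τ₁ →
      d.flatChart y ∈ 𝓢.metric.causalPast 𝓢.timeOrientation (certifiedSlab d R τ₁) := by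
    intro y hy hyF
    by_cases h : τ₁ < y.1 0
    · exact (hyF (Or.inl ⟨y, h, rfl⟩)).elim
    · exact flatBoarding 𝓢 O d R R₀ ha horth hd h1 h5 h6 h7 h8 h9 τ₁ y hy (not_lt.mp h)
  rcases hq with hq | hq
  · -- radiation zone
    obtain ⟨y, hy, rfl⟩ := hq
    exact flat y hy hqF
  · -- hole region `i`
    obtain ⟨i, hqi⟩ := mem_iUnion.mp hq
    obtain ⟨x, hxt, rfl⟩ := hqi
    have hxt' : d.τ₀ < (d.background i).time x.1 := hxt
    have hmono : Monotone (R i) := (h1 i).1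
    by_cases hA : (d.background i).time x.1 < τ₁ ∧ (d.background i).radius x.1 < R i τ₁
    · -- LOOKUP: wide anchoring
      exact wideAnchoring d R R₀ hb (fun i s ↦ ((h1 i).2.2 s).1) hτ₁ i ⟨x, ⟨hxt', hA.1, hA.2⟩, rfl⟩
    · by_cases hD : (d.background i).time x.1 = τ₁ ∧ (d.background i).radius x.1 ≤ R i τ₁
      · -- on the disc
        refine LorentzianMetric.subset_causalPast _ _ _ (Or.inr (mem_iUnion.mpr ⟨i, x, ?_, rfl⟩))
        exact ⟨hD.1, hD.2⟩
      · -- `Rᵢ(t) ≤ r`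
        have hlo : R i ((d.background i).time x.1) ≤ (d.background i).radius x.1 := by
          rcases lt_trichotomy ((d.background i).time x.1) τ₁ with hlt | heq | hgt
          · have h1' : R i τ₁ ≤ (d.background i).radius x.1 := by
              by_contra h; push Not at h; exact hA ⟨hlt, h⟩
            exact (hmono hlt.le).trans h1'
          · have h1' : R i τ₁ < (d.background i).radius x.1 := by
              by_contra h; push Not at h; exact hD ⟨heq, h⟩
            rw [heq]; exact h1'.le
          · by_contra h; push Not at h
            exact hqF (Or.inr (mem_iUnion.mpr ⟨i, x, ⟨hgt, h.le⟩, rfl⟩))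
        by_cases hcol : (d.background i).radius x.1 ≤ R i ((d.background i).time x.1) + 1
        · -- collar: flat-late in the same coordinates
          obtain ⟨hy', hEq, hlag⟩ := collar_flat d R h6 h8 h9 h12 i x hxt' hlo hcol
          rw [hEq] at hqF ⊢
          exact flat ⟨x.1, hy'⟩ (lt_of_lt_of_le hxt' hlag) hqF
        · -- far leaf: in the radiation zone by SEAMED (10)
          push Not at hcol
          have hfar : d.chart i x ∈ d.chart i '' {x | d.τ₀ < (d.background i).time x.1 ∧
              R i ((d.background i).time x.1) + 1 < (d.background i).radius x.1} :=
            ⟨x, ⟨hxt', hcol⟩, rfl⟩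
          obtain ⟨y, hy, hyEq⟩ := h10 i hfar
          rw [← hyEq] at hqF ⊢
          exact flat y hy hqF

/-- **Abstract first-entry covering lemma** (metric-free). In any spacetime: if `F` is open, `F ⊆ C ⊆ O ⊆ I⁻(C)`, `O`
is causally convex, every point of `C \ F` and every point of `(closure F ∩ O) \ F` lies in `J⁻(S)`,
then `O \ F ⊆ J⁻(S)`: `p ≪ q ∈ C`; if `q ∈ F`, the first parameter of the timelike curve in `F` gives
`q* ∈ closure F \ F`, `q* ∈ O` by causal convexity, `p ≤ q* ∈ J⁻(S)`, and `J⁻ ∘ J⁻ = J⁻`.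
O'Neill 1983, Ch. 14, pp. 402–403; Minguzzi arXiv:1709.06494, §2. [folklore] -/
theorem firstEntryCovering (𝓢 : Spacetime.{0} 4) (O C F S : Set 𝓢.carrier)
    (hF : IsOpen F) (hCO : C ⊆ O)
    (hOI : O ⊆ 𝓢.metric.chronologicalPast 𝓢.timeOrientation C)
    (hconv : ∀ p ∈ O, ∀ q ∈ O, 𝓢.metric.causalFuture 𝓢.timeOrientation {p} ∩
        𝓢.metric.causalPast 𝓢.timeOrientation {q} ⊆ O)
    (hCF : C \ F ⊆ 𝓢.metric.causalPast 𝓢.timeOrientation S)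
    (hfront : (closure F ∩ O) \ F ⊆ 𝓢.metric.causalPast 𝓢.timeOrientation S) :
    O \ F ⊆ 𝓢.metric.causalPast 𝓢.timeOrientation S := by
  intro p hp
  obtain ⟨hpO, hpF⟩ := hp
  -- `p ≪ c` for some `c ∈ C`
  have hpI : p ∈ 𝓢.metric.chronologicalFuture 𝓢.timeOrientation.reverse C := hOI hpO
  rw [LorentzianMetric.chronologicalFuture_eq_biUnion] at hpI
  simp only [Set.mem_iUnion, exists_prop] at hpI
  obtain ⟨c, hcC, hpc⟩ := hpI
  by_cases hcF : c ∈ F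
  swap
  · exact causalPast_trans (LorentzianMetric.chronologicalFuture_subset_causalFuture 𝓢.metric
      𝓢.timeOrientation.reverse {c} hpc) (hCF ⟨hcC, hcF⟩)
  -- the timelike curve from `p` to `c ∈ F`
  have hcp : c ∈ 𝓢.metric.chronologicalFuture 𝓢.timeOrientation {p} :=
    LorentzianMetric.mem_chronologicalFuture_of_mem_chronologicalPast hpc
  obtain ⟨p', hp', γ, a, b, hab, hγ, hγa, hγb⟩ := hcp
  rw [Set.mem_singleton_iff] at hp'
  have hγa' : γ a = p := hγa.trans hp'
  have hγc : ∀ s ∈ Set.Icc a b, ContinuousAt γ s := fun s hs ↦ (hγ s hs).1.continuousAt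
  -- first entry: infimum of the parameters mapped into `F`
  let A : Set ℝ := {s | s ∈ Set.Icc a b ∧ γ s ∈ F}
  have hbA : b ∈ A := ⟨Set.right_mem_Icc.mpr hab.le, by show γ b ∈ F; rw [hγb]; exact hcF⟩
  have hAne : A.Nonempty := ⟨b, hbA⟩
  have hAbdd : BddBelow A := ⟨a, fun s hs ↦ hs.1.1⟩
  have hs₀b : sInf A ≤ b := csInf_le hAbdd hbA
  have has₀ : a ≤ sInf A := le_csInf hAne fun s hs ↦ hs.1.1
  have hs₀I : sInf A ∈ Set.Icc a b := ⟨has₀, hs₀b⟩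
  -- `γ (sInf A) ∈ closure F`
  have hcl : γ (sInf A) ∈ closure F := by
    have h1 : sInf A ∈ closure A := csInf_mem_closure hAne hAbdd
    have h2 : γ (sInf A) ∈ closure (γ '' A) :=
      ContinuousWithinAt.mem_closure_image (hγc _ hs₀I).continuousWithinAt h1
    refine closure_mono ?_ h2
    rintro _ ⟨s, hs, rfl⟩
    exact hs.2
  -- `γ (sInf A) ∉ F` (openness of `F`; at `a` because `p ∉ F`)
  have hnF : γ (sInf A) ∉ F := by
    intro hF₀
    have hne : a ≠ sInf A := by
      intro h
      rw [← h, hγa'] at hF₀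
      exact hpF hF₀
    have has₀' : a < sInf A := lt_of_le_of_ne has₀ hne
    have hnhds : γ ⁻¹' F ∈ 𝓝 (sInf A) := (hγc _ hs₀I).preimage_mem_nhds (hF.mem_nhds hF₀)
    obtain ⟨ε, hε, hball⟩ := Metric.mem_nhds_iff.mp hnhds
    obtain ⟨s₁, hs₁a, hs₁ε, hs₁lt⟩ : ∃ s₁, a ≤ s₁ ∧ sInf A - ε / 2 ≤ s₁ ∧ s₁ < sInf A :=
      ⟨max a (sInf A - ε / 2), le_max_left _ _, le_max_right _ _, max_lt has₀' (by linarith)⟩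
    have hs₁A : s₁ ∈ A := by
      refine ⟨⟨hs₁a, hs₁lt.le.trans hs₀b⟩, ?_⟩
      apply hball
      rw [Metric.mem_ball, Real.dist_eq, abs_sub_lt_iff]
      constructor <;> linarith
    exact absurd (csInf_le hAbdd hs₁A) (not_le.mpr hs₁lt)
  -- `p ≤ γ (sInf A)`
  have hps₀ : p ∈ 𝓢.metric.causalPast 𝓢.timeOrientation {γ (sInf A)} := by
    rcases eq_or_lt_of_le has₀ with h | h
    · rw [← h, hγa']
      exact LorentzianMetric.subset_causalPast _ _ _ (Set.mem_singleton p)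
    · exact LorentzianMetric.mem_causalPast_singleton_iff.mpr (Or.inr ⟨p, Set.mem_singleton p,
        γ, a, sInf A, h, (hγ.mono (Set.Icc_subset_Icc le_rfl hs₀b)).isFutureCausalCurveOn,
        hγa', rfl⟩)
  -- `γ (sInf A) ≤ c`
  have hs₀c : γ (sInf A) ∈ 𝓢.metric.causalPast 𝓢.timeOrientation {c} := by
    rcases eq_or_lt_of_le hs₀b with h | h
    · rw [h, hγb]
      exact LorentzianMetric.subset_causalPast _ _ _ (Set.mem_singleton c)
    · exact LorentzianMetric.mem_causalPast_singleton_iff.mpr (Or.inr ⟨γ (sInf A),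
        Set.mem_singleton _, γ, sInf A, b, h,
        (hγ.mono (Set.Icc_subset_Icc has₀ le_rfl)).isFutureCausalCurveOn, rfl, hγb⟩)
  -- causal convexity: the first-entry point lies in `O`
  have hs₀O : γ (sInf A) ∈ O :=
    hconv p hpO c (hCO hcC) ⟨LorentzianMetric.mem_causalPast_singleton_iff.mp hps₀, hs₀c⟩
  -- frontier hypothesis and `J⁻ ∘ J⁻ = J⁻`
  exact causalPast_trans hps₀ (hfront ⟨⟨hcl, hs₀O⟩, hnF⟩)

/-- **The two properties of `O = exteriorOf 𝒟 U = J⁺(ι X) ∩ I⁻(U)` the line uses**: `O ⊆ I⁻(U)`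
and causal convexity `J⁺(p) ∩ J⁻(q) ⊆ O`
for `p, q ∈ O` (transitivity of `J⁺`; push-up `x ≤ q ≪ c ⇒ x ≪ c`; time duality). This is the only
place the shape `O = exteriorOf` enters; no field equation, maximality or admissibility is used
(the disprover's §2). Chruściel–Costa–Heusler 2012, §2.4; O'Neill 1983, Ch. 14, p. 402. [folklore] -/
theorem exteriorOf_causallyConvex {X : Type} [TopologicalSpace X] [ChartedSpace E3 X]
    [IsManifold (𝓡 3) ∞ X] [ConnectedSpace X] {D : InitialDataSet (𝓡 3) X}
    (𝒟 : VacuumCauchyDevelopment D) (U : Set 𝒟.carrier) :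
    (exteriorOf 𝒟.toCauchyDevelopment U ⊆
        𝒟.toSpacetime.metric.chronologicalPast 𝒟.toSpacetime.timeOrientation U) ∧
    ∀ p ∈ exteriorOf 𝒟.toCauchyDevelopment U, ∀ q ∈ exteriorOf 𝒟.toCauchyDevelopment U,
      𝒟.toSpacetime.metric.causalFuture 𝒟.toSpacetime.timeOrientation {p} ∩
          𝒟.toSpacetime.metric.causalPast 𝒟.toSpacetime.timeOrientation {q} ⊆
        exteriorOf 𝒟.toCauchyDevelopment U := by
  refine ⟨Set.inter_subset_right, ?_⟩
  rintro p ⟨hpS, -⟩ q ⟨-, hqU⟩ x ⟨hxp, hxq⟩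
  have hn2 : (2 : WithTop ℕ∞) ≤ ((⊤ : ℕ∞) : WithTop ℕ∞) := WithTop.coe_le_coe.mpr le_top
  have hn1 : (1 : WithTop ℕ∞) ≤ ((⊤ : ℕ∞) : WithTop ℕ∞) := WithTop.coe_le_coe.mpr le_top
  refine ⟨?_, ?_⟩
  · -- `x ∈ J⁺(ι X)` : `J⁺(J⁺ S) = J⁺ S`
    have hx : x ∈ 𝒟.toSpacetime.metric.causalFuture 𝒟.toSpacetime.timeOrientation
        (𝒟.toSpacetime.metric.causalFuture 𝒟.toSpacetime.timeOrientation (range 𝒟.embed)) :=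
      LorentzianMetric.causalFuture_mono (Set.singleton_subset_iff.mpr hpS) hxp
    rwa [LorentzianMetric.causalFuture_causalFuture_eq hn2] at hx
  · -- `x ∈ I⁻(U)` : `q ≪⁻ c ∈ U`, `x ≤ q ≪ c ⇒ x ≪ c`
    have hqU' : q ∈ 𝒟.toSpacetime.metric.chronologicalFuture
        𝒟.toSpacetime.timeOrientation.reverse U := hqU
    rw [LorentzianMetric.chronologicalFuture_eq_biUnion] at hqU'
    simp only [Set.mem_iUnion, exists_prop] at hqU'
    obtain ⟨c, hcU, hqc⟩ := hqU'
    have hcq : c ∈ 𝒟.toSpacetime.metric.chronologicalFuture 𝒟.toSpacetime.timeOrientation {q} :=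
      LorentzianMetric.mem_chronologicalFuture_of_mem_chronologicalPast hqc
    have hqx : q ∈ 𝒟.toSpacetime.metric.causalFuture 𝒟.toSpacetime.timeOrientation {x} :=
      LorentzianMetric.mem_causalPast_singleton_iff.mp hxq
    have hcx : c ∈ 𝒟.toSpacetime.metric.chronologicalFuture 𝒟.toSpacetime.timeOrientation {x} :=
      LorentzianMetric.mem_chronologicalFuture_of_mem_causalFuture hn1 hqx hcq
    have hxc := LorentzianMetric.mem_chronologicalPast_of_mem_chronologicalFuture hcx
    show x ∈ 𝒟.toSpacetime.metric.chronologicalFuture 𝒟.toSpacetime.timeOrientation.reverse U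
    rw [LorentzianMetric.chronologicalFuture_eq_biUnion]
    simp only [Set.mem_iUnion, exists_prop]
    exact ⟨c, hcU, hxc⟩

/-- **FRONTIER**: the frontier of the certified late region inside `O` lies in `J⁻` of the certified
slab — the rim enumeration (`stub_rim`) lands on the slab (in its own causal past) or on ride-able
certified tube points, which the ride drains (`tubeRide`). Clauses: Hc (a)-orthochronous, (c); Sm (1),
(5), (8), (11). O'Neill 1983, Ch. 14, p. 403. [folklore] -/
theorem frontierBelowSlab (𝓢 : Spacetime.{0} 4) (O : Set 𝓢.carrier) (d : FinalStateDecomposition 𝓢 O 2)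
    (R : Fin d.N → ℝ → ℝ) (R₀ : ℝ)
    (horth : ∀ i, 0 < ((d.motion i).1 : E4 ≃L[ℝ] E4) (E4.basisVector 0) 0)
    (hcl : ∀ i (τ' : ℝ) (ϱ : ℝ → ℝ), Continuous ϱ → d.τ₀ < τ' →
      closure (d.chart i '' {x | τ' ≤ (d.background i).time x.1 ∧
        (d.background i).radius x.1 ≤ ϱ ((d.background i).time x.1)}) ∩ O ⊆
      d.chart i '' {x | τ' ≤ (d.background i).time x.1 ∧
        (d.background i).radius x.1 ≤ ϱ ((d.background i).time x.1)})
    (h1 : ∀ i, Monotone (R i) ∧ Continuous (R i) ∧ ∀ s, R₀ + 4 ≤ R i s ∧ R₀ ≤ d.excision i s)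
    (h5 : ∀ i (x : (d.background i).domain),
      (d.τ₀ ≤ (d.background i).time x.1 ∨ d.τ₀ ≤ x.1 0) → R₀ ≤ (d.background i).radius x.1 →
      (d.background i).radius x.1 ≤ R i ((d.background i).time x.1) →
      𝓢.timeOrientation.IsFutureDirected
        (mfderiv 𝓘(ℝ, E4) (𝓡 4) (d.chart i) x (((d.motion i).1 : E4 ≃L[ℝ] E4) (E4.basisVector 0))))
    (h8 : ∀ j (y : E4), d.τ₀ ≤ y 0 → (d.background j).radius y ≤ d.excision j (y 0) →
      (d.background j).radius y + 2 ≤ R j ((d.background j).time y))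
    (h11 : ∀ τ' : ℝ, d.τ₀ < τ' → closure (d.flatChart '' {y | τ' ≤ y.1 0}) ⊆
      d.flatChart '' {y | τ' ≤ y.1 0} ∪
        ⋃ j, d.chart j '' {x | τ' ≤ x.1 0 ∧ (d.background j).radius x.1 = d.excision j (x.1 0)})
    (τ₁ : ℝ) (hτ₁ : d.τ₀ < τ₁) :
    (closure (certifiedLate d R τ₁) ∩ O) \ certifiedLate d R τ₁ ⊆
      𝓢.metric.causalPast 𝓢.timeOrientation (certifiedSlab d R τ₁) := by
  intro z hz
  rcases stub_rim 𝓢 O d R R₀ hcl (fun i ↦ ⟨(h1 i).2.1, fun s ↦ ((h1 i).2.2 s).2⟩) h8 h11 τ₁ hτ₁ hz with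
    hS | hT
  · exact LorentzianMetric.subset_causalPast _ _ _ hS
  · exact tubeRide 𝓢 O d R R₀ horth (fun i ↦ (h1 i).1) h5 τ₁ hT

/-- **`SeamedChartsExhaust` (crux of route StarvedNecks, rank 4) holds.** For every admissible datum,
MGHD `𝒟`, region `O`, `C²` decomposition `d` of `O`, radii `R`, `R₀`: `O = exteriorOf 𝒟 d.charted`,
HonestCore and SEAMED imply `HasExhaustiveCharts d` — for the given `R`, clause (i) is SEAMED (2) and
clause (ii) is `firstEntryCovering` over the cofinal, causally convex exterior, fed by `chartedReach`
(REACH) and `frontierBelowSlab` (FRONTIER) and the openness of the certified late region; the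
re-typed clause (honest GROWING radii, audit 2026-08-16 (B)) is then witnessed by the diagonally
enlarged radii `max (Rᵢ τ) (Rgᵢ τ)` (`DiagonalRadii` on the structure's fixed-radius convergence).
O'Neill 1983, Ch. 14, pp. 402–403; DHRT arXiv:2104.08222, §1. [folklore] -/
theorem seamedChartsExhaust :
    _root_.Summit.FinalStateConjecture.FinalStateConjecture.Theses.StarvedNecks.SeamedChartsExhaust := by
  intro X _ _ _ _ D _ 𝒟 _ O d R R₀ hO hc hs
  obtain ⟨ha, hb, hcl, hd⟩ := hc
  obtain ⟨h1, h2, -, -, h5, h6, h7, h8, h9, h10, h11, h12⟩ := hs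
  obtain ⟨hOI, hconv⟩ := exteriorOf_causallyConvex 𝒟 d.charted
  rw [← hO] at hOI hconv
  -- covering clause (ii) for the SEAMED radii `R` themselves (the line's composition, unchanged)
  have hcov : ∀ τ₁ : ℝ, d.τ₀ < τ₁ →
      O \ certifiedLate d R τ₁ ⊆
        𝒟.metric.causalPast 𝒟.timeOrientation (certifiedSlab d R τ₁) := fun τ₁ hτ₁ ↦
    firstEntryCovering 𝒟.toSpacetime O d.charted (certifiedLate d R τ₁) (certifiedSlab d R τ₁)
      (isOpen_certifiedLate d R (fun i ↦ (h1 i).2.1) h6 h8 h9 h12 τ₁ hτ₁) d.charted_subset hOI hconv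
      (chartedReach 𝒟.toSpacetime O d R R₀ (fun i ↦ (ha i).2.1) (fun i ↦ (ha i).2.2) hb hd h1 h5 h6 h7
        h8 h9 h10 h12 τ₁ hτ₁)
      (frontierBelowSlab 𝒟.toSpacetime O d R R₀ (fun i ↦ (ha i).2.2) hcl h1 h5 h8 h11 τ₁ hτ₁)
  -- HONEST GROWING RADII (re-typed `HasExhaustiveCharts`, audit 2026-08-16 (B)): enlarge `R` to
  -- `R' i τ := max (R i τ) (Rg i τ)` with `Rg i → ∞` diagonal radii (`DiagonalRadii`, proved) of the
  -- structure's fixed-radius convergence; deviation at `max` = `max` of deviations (monotone in the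
  -- radius), `certifiedLate`/`certifiedSlab`/`J⁻` monotone in the radii, `max (r₊,0)+1 ≤ 2M+1 ≤ R₀+4`.
  -- (Factored statement: `SeamedChartsExhaust.HonestRadii.hasExhaustiveCharts_of_covering`.)
  have hdiag : ∀ a : ℝ → ℝ → ℝ≥0∞, (∀ τ, Monotone (fun ρ ↦ a ρ τ)) →
      (∀ ρ, Tendsto (fun τ ↦ a ρ τ) atTop (𝓝 0)) → ∃ Rg : ℝ → ℝ, Monotone Rg ∧ Continuous Rg ∧
        Tendsto Rg atTop atTop ∧ Tendsto (fun τ ↦ a (Rg τ) τ) atTop (𝓝 0) :=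
    Theorems.DiagonalRadii.diagonalRadii_proof
  have hmn : ∀ i τ, Monotone
      (fun ρ ↦ 𝒟.toSpacetime.truncDeviationCk (d.background i) (d.chart i) 2 ρ τ) :=
    fun i τ ρ ρ' h ↦ 𝒟.toSpacetime.truncDeviationCk_mono (d.background i) (d.chart i) 2 h τ
  have hRg : ∀ i, ∃ Rg : ℝ → ℝ, Tendsto Rg atTop atTop ∧ Tendsto
      (fun τ ↦ 𝒟.toSpacetime.truncDeviationCk (d.background i) (d.chart i) 2 (Rg τ) τ) atTop (𝓝 0) := by
    intro i
    obtain ⟨Rg, -, -, htop, hlim⟩ :=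
      hdiag (fun ρ τ ↦ 𝒟.toSpacetime.truncDeviationCk (d.background i) (d.chart i) 2 ρ τ) (hmn i)
        (d.tendsto_truncDeviationCk i)
    exact ⟨Rg, htop, hlim⟩
  choose Rg hRg_top hRg_lim using hRg
  have hle : ∀ i τ, R i τ ≤ max (R i τ) (Rg i τ) := fun i τ ↦ le_max_left _ _
  refine ⟨fun i τ ↦ max (R i τ) (Rg i τ), fun i ↦ ⟨?_, fun τ ↦ ?_⟩, fun i ↦ ?_, fun τ₁ hτ₁ ↦ ?_⟩
  · exact tendsto_atTop_mono (fun τ ↦ le_max_right _ _) (hRg_top i)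
  · have h2M : Kerr.rPlus (d.mass i) (d.spin i) ≤ 2 * d.mass i :=
      Kerr.rPlus_le_two_mul (d.mass_pos i).le
    have hmax : max (Kerr.rPlus (d.mass i) (d.spin i)) 0 ≤ 2 * d.mass i :=
      max_le h2M (by linarith [d.mass_pos i])
    calc max (Kerr.rPlus (d.mass i) (d.spin i)) 0 + 1 ≤ R₀ + 4 := by
          linarith [(ha i).2.1, d.mass_pos i]
      _ ≤ R i τ := ((h1 i).2.2 τ).1
      _ ≤ max (R i τ) (Rg i τ) := hle i τ
  · have heq : (fun τ ↦ 𝒟.toSpacetime.truncDeviationCk (d.background i) (d.chart i) 2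
          (max (R i τ) (Rg i τ)) τ) =
        fun τ ↦ max (𝒟.toSpacetime.truncDeviationCk (d.background i) (d.chart i) 2 (R i τ) τ)
          (𝒟.toSpacetime.truncDeviationCk (d.background i) (d.chart i) 2 (Rg i τ) τ) := by
      funext τ
      exact (hmn i τ).map_max
    rw [heq]
    simpa using (h2 i).max (hRg_lim i)
  · have hlate : certifiedLate d R τ₁ ⊆ certifiedLate d (fun i τ ↦ max (R i τ) (Rg i τ)) τ₁ := by
      refine union_subset_union_right _ (iUnion_mono fun i ↦ image_mono ?_)
      intro x hx
      exact ⟨hx.1, hx.2.trans (hle i _)⟩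
    have hslab : certifiedSlab d R τ₁ ⊆ certifiedSlab d (fun i τ ↦ max (R i τ) (Rg i τ)) τ₁ :=
      union_subset_union_right _ (iUnion_mono fun i ↦
        image_mono ((d.background i).truncTimeSlab_mono (hle i τ₁) τ₁))
    intro p hp
    exact LorentzianMetric.causalFuture_mono hslab (hcov τ₁ hτ₁ ⟨hp.1, fun h ↦ hp.2 (hlate h)⟩)

end Summit.FinalStateConjecture.FinalStateConjecture.Theorems.SeamedChartsExhaust.WideAnchoring

end
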